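import Summits.ValiantsHypothesis.ValiantsHypothesis.Theorems.NcBlockForms
import HarnessLib

/-!
# The frame split (Hrubeš–Wigderson–Yehudayoff, Lemma C.2 as one identity) — lift inequality 2a/3

Workshop file for the node `CommutativityDial` (decomp-valiant lens 6; road K5a′, stage 3b-i towards
the named fact `HWY10_thm_1_7`), on top of `NcBlockForms` (framed bodies, the block reading `Λ_r`).
HWY's Lemma C.2 has six cases (body in the left half / centre / right half × the choice of the fixed
bilinear factor). Here they are ONE identity: for a FIXED-FACTOR INTERVAL `F = [f₁, f₁+2r)` and a
body window `G = [ρ, ρ+e)`, the coefficient of the word `w` in a framed body `α·G·ω` is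
`Σ_t fixedCoef_t(w) · freeCoef_t(w)` (`coeff_framed_eq_sum`), the index `t` a word supported on
`F Δ G`, `fixedCoef_t` reading `w` on `F` only and NOT reading the frame, `freeCoef_t` reading `w`
off `F` only (`fixedCoef_congr`, `freeCoef_congr`); the sum collapses at `t₀ = w·𝟙_{F Δ G}`. Under
`Λ_r` this gives, uniformly in the SCHEME `m ∈ {0,1,2}` (`f₁ = m·r`; blocks 12 straight, 23 twisted,
34 straight), `Λ_r (α·G·ω) = Σ_t fixed_t(X,Y) · free_t(X,Y)` with fixed matrices independent of the
frame (`blockForm_framed`), and the words supported on `F Δ G` number `≤ 2^{|F Δ G|}`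
(`card_supported_le`). The dispatch of a scheme with `|F Δ G| ≤ r`, the index count, Proposition C.3
and Corollary C.4 are `NcSOSLift`.
HONEST FRAMING: a lemma in print (HWY, STOC 2010, App. C, Lemma C.2 = J. AMS 24 (2011) §5),
kernel-new bookkeeping only (one generic identity instead of six cases); every commutative ring;
no lower bound here; `VP ≠ VNP` untouched.
-/

noncomputable section

namespace Summit.ValiantsHypothesis.ValiantsHypothesis.Theorems.NcFrameSplit

open Literature.Computability.AlgebraicComplexity
open Summit.ValiantsHypothesis.ValiantsHypothesis.Theorems.NcCentralWidth
open Summit.ValiantsHypothesis.ValiantsHypothesis.Theorems.NcSOSDegreeFour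
open Summit.ValiantsHypothesis.ValiantsHypothesis.Theorems.NcBlockForms
open MvPolynomial (X)

universe u

variable (F : Type u) [CommRing F]

section FrameSplit

/-- The FIXED-SIDE COEFFICIENT of scheme `F = [f₁, f₁+2r)`, window `G = [ρ, ρ+e)`, index `t`: it
reads `w` on `F` only — `[ (w on F∩G, t on G∖F) ] G` if `w = t` on `F∖G`, else `0`.
[cite: HrubesWigdersonYehudayoff2010, Lemma C.2] -/
def fixedCoef (r f₁ ρ e : ℕ) (t : Fin (4 * r) → Fin 2) (G : FreeAlgebra F (Fin 2))
    (w : Fin (4 * r) → Fin 2) : F :=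
  if (∀ p : Fin (4 * r), f₁ ≤ p.val → p.val < f₁ + 2 * r → ¬(ρ ≤ p.val ∧ p.val < ρ + e) →
      w p = t p) then
    coeff (List.ofFn fun q : Fin e => if hq : ρ + q.val < 4 * r then
      (if f₁ ≤ ρ + q.val ∧ ρ + q.val < f₁ + 2 * r then w ⟨ρ + q.val, hq⟩ else t ⟨ρ + q.val, hq⟩)
      else 0) G
  else 0

/-- The FREE-SIDE COEFFICIENT: it reads `w` off `F` only — `[t supported on F Δ G] · [t = c on F∖G]
· [w = c off F ∪ G] · [w = t on G∖F]`. [cite: HrubesWigdersonYehudayoff2010, Lemma C.2] -/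
def freeCoef (r f₁ ρ e : ℕ) (t c w : Fin (4 * r) → Fin 2) : F :=
  if (∀ p : Fin (4 * r), ((f₁ ≤ p.val ∧ p.val < f₁ + 2 * r) ↔ (ρ ≤ p.val ∧ p.val < ρ + e)) →
        t p = 0) ∧
      (∀ p : Fin (4 * r), (f₁ ≤ p.val ∧ p.val < f₁ + 2 * r) → ¬(ρ ≤ p.val ∧ p.val < ρ + e) →
        t p = c p) ∧
      (∀ p : Fin (4 * r), ¬(f₁ ≤ p.val ∧ p.val < f₁ + 2 * r) → ¬(ρ ≤ p.val ∧ p.val < ρ + e) →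
        w p = c p) ∧
      (∀ p : Fin (4 * r), ¬(f₁ ≤ p.val ∧ p.val < f₁ + 2 * r) → (ρ ≤ p.val ∧ p.val < ρ + e) →
        w p = t p) then 1 else 0

/-- LOCALITY of the fixed side: it depends on `w|_F` only. [cite: HrubesWigdersonYehudayoff2010, Lemma C.2] -/
theorem fixedCoef_congr {r f₁ ρ e : ℕ} (t : Fin (4 * r) → Fin 2) (G : FreeAlgebra F (Fin 2))
    {w w' : Fin (4 * r) → Fin 2}
    (h : ∀ p : Fin (4 * r), f₁ ≤ p.val → p.val < f₁ + 2 * r → w p = w' p) :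
    fixedCoef F r f₁ ρ e t G w = fixedCoef F r f₁ ρ e t G w' := by
  have hl : (fun q : Fin e => if hq : ρ + q.val < 4 * r then
      (if f₁ ≤ ρ + q.val ∧ ρ + q.val < f₁ + 2 * r then w ⟨ρ + q.val, hq⟩ else t ⟨ρ + q.val, hq⟩)
      else (0 : Fin 2)) = (fun q : Fin e => if hq : ρ + q.val < 4 * r then
      (if f₁ ≤ ρ + q.val ∧ ρ + q.val < f₁ + 2 * r then w' ⟨ρ + q.val, hq⟩ else t ⟨ρ + q.val, hq⟩)
      else 0) := by
    funext q
    by_cases hq : ρ + q.val < 4 * r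
    · rw [dif_pos hq, dif_pos hq]
      by_cases hF : f₁ ≤ ρ + q.val ∧ ρ + q.val < f₁ + 2 * r
      · rw [if_pos hF, if_pos hF]; exact h _ hF.1 hF.2
      · rw [if_neg hF, if_neg hF]
    · rw [dif_neg hq, dif_neg hq]
  unfold fixedCoef
  rw [hl]
  by_cases H : ∀ p : Fin (4 * r), f₁ ≤ p.val → p.val < f₁ + 2 * r →
      ¬(ρ ≤ p.val ∧ p.val < ρ + e) → w p = t p
  · rw [if_pos H, if_pos (fun p a b hc => (h p a b).symm.trans (H p a b hc))]
  · rw [if_neg H, if_neg (fun H' => H fun p a b hc => (h p a b).trans (H' p a b hc))]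

/-- LOCALITY of the free side: it depends on `w|_{F^c}` only. [cite: HrubesWigdersonYehudayoff2010, Lemma C.2] -/
theorem freeCoef_congr {r f₁ ρ e : ℕ} (t c : Fin (4 * r) → Fin 2) {w w' : Fin (4 * r) → Fin 2}
    (h : ∀ p : Fin (4 * r), ¬(f₁ ≤ p.val ∧ p.val < f₁ + 2 * r) → w p = w' p) :
    freeCoef F r f₁ ρ e t c w = freeCoef F r f₁ ρ e t c w' := by
  unfold freeCoef
  by_cases H : (∀ p : Fin (4 * r), ((f₁ ≤ p.val ∧ p.val < f₁ + 2 * r) ↔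
        (ρ ≤ p.val ∧ p.val < ρ + e)) → t p = 0) ∧
      (∀ p : Fin (4 * r), (f₁ ≤ p.val ∧ p.val < f₁ + 2 * r) → ¬(ρ ≤ p.val ∧ p.val < ρ + e) →
        t p = c p) ∧
      (∀ p : Fin (4 * r), ¬(f₁ ≤ p.val ∧ p.val < f₁ + 2 * r) → ¬(ρ ≤ p.val ∧ p.val < ρ + e) →
        w p = c p) ∧
      (∀ p : Fin (4 * r), ¬(f₁ ≤ p.val ∧ p.val < f₁ + 2 * r) → (ρ ≤ p.val ∧ p.val < ρ + e) →
        w p = t p)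
  · rw [if_pos H, if_pos ⟨H.1, H.2.1, fun p a b => (h p a).symm.trans (H.2.2.1 p a b),
      fun p a b => (h p a).symm.trans (H.2.2.2 p a b)⟩]
  · rw [if_neg H, if_neg fun H' => H ⟨H'.1, H'.2.1, fun p a b => (h p a).trans (H'.2.2.1 p a b),
      fun p a b => (h p a).trans (H'.2.2.2 p a b)⟩]

/-- **The frame split** (HWY's Lemma C.2, all six cases at once): for every scheme `f₁` and window
`[ρ, ρ+e)`, `[w](α·G·ω) = Σ_t fixedCoef_t(w) · freeCoef_t(w)`; the sum collapses at the single index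
`t₀ = w·𝟙_{F Δ G}`. [cite: HrubesWigdersonYehudayoff2010, Lemma C.2] -/
theorem coeff_framed_eq_sum {r f₁ ρ e : ℕ} (hρe : ρ + e ≤ 4 * r) {G : FreeAlgebra F (Fin 2)}
    (hG : degPart (4 * r) e G = G) (c w : Fin (4 * r) → Fin 2) :
    coeff (List.ofFn w) (framed hρe c G) =
      ∑ t : Fin (4 * r) → Fin 2, fixedCoef F r f₁ ρ e t G w * freeCoef F r f₁ ρ e t c w := by
  classical
  rw [coeff_frame hρe hG c w]
  obtain ⟨t₀, ht₀⟩ : ∃ t₀ : Fin (4 * r) → Fin 2, ∀ p, t₀ p =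
      if ((f₁ ≤ p.val ∧ p.val < f₁ + 2 * r) ↔ (ρ ≤ p.val ∧ p.val < ρ + e)) then 0 else w p :=
    ⟨_, fun p => rfl⟩
  rw [Finset.sum_eq_single t₀]
  · have hfix : fixedCoef F r f₁ ρ e t₀ G w =
        coeff (List.ofFn fun q : Fin e => w ⟨ρ + q.val, by have := q.isLt; omega⟩) G := by
      unfold fixedCoef
      rw [if_pos ?_]
      · refine congrArg (fun l => coeff l G) (congrArg List.ofFn (funext fun q => ?_))
        have hq' := q.isLt
        have hq : ρ + q.val < 4 * r := by omega
        rw [dif_pos hq]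
        by_cases hF : f₁ ≤ ρ + q.val ∧ ρ + q.val < f₁ + 2 * r
        · rw [if_pos hF]
        · rw [if_neg hF, ht₀, if_neg]
          intro hiff; exact hF (hiff.2 ⟨by dsimp only; omega, by dsimp only; omega⟩)
      · intro p a b hc
        rw [ht₀, if_neg (fun hiff => hc (hiff.1 ⟨a, b⟩))]
    have hfree : freeCoef F r f₁ ρ e t₀ c w =
        if (∀ p : Fin (4 * r), ¬(ρ ≤ p.val ∧ p.val < ρ + e) → w p = c p) then 1 else 0 := by
      unfold freeCoef
      by_cases H : ∀ p : Fin (4 * r), ¬(ρ ≤ p.val ∧ p.val < ρ + e) → w p = c p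
      · rw [if_pos H, if_pos]
        refine ⟨fun p hiff => by rw [ht₀, if_pos hiff], fun p hF hG' => ?_, fun p _ hG' => H p hG',
          fun p hF hG' => by rw [ht₀, if_neg (fun hiff => hF (hiff.2 hG'))]⟩
        rw [ht₀, if_neg (fun hiff => hG' (hiff.1 hF))]; exact H p hG'
      · rw [if_neg H, if_neg]
        rintro ⟨-, h₂, h₃, -⟩
        refine H fun p hG' => ?_
        by_cases hF : f₁ ≤ p.val ∧ p.val < f₁ + 2 * r
        · have h2p := h₂ p hF hG'
          rw [ht₀, if_neg (fun hiff => hG' (hiff.1 hF))] at h2p; exact h2p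
        · exact h₃ p hF hG'
    rw [hfix, hfree]
    split_ifs <;> simp only [mul_one, mul_zero]
  · intro t _ hne
    obtain ⟨p, hp⟩ : ∃ p, t p ≠ t₀ p := Function.ne_iff.1 hne
    by_cases hiff : ((f₁ ≤ p.val ∧ p.val < f₁ + 2 * r) ↔ (ρ ≤ p.val ∧ p.val < ρ + e))
    · have ht : t₀ p = 0 := by rw [ht₀, if_pos hiff]
      have h0 : freeCoef F r f₁ ρ e t c w = 0 := by
        unfold freeCoef; rw [if_neg]; rintro ⟨h₁, -, -, -⟩; exact hp ((h₁ p hiff).trans ht.symm)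
      rw [h0, mul_zero]
    · have ht : t₀ p = w p := by rw [ht₀, if_neg hiff]
      by_cases hF : f₁ ≤ p.val ∧ p.val < f₁ + 2 * r
      · have hG' : ¬(ρ ≤ p.val ∧ p.val < ρ + e) := fun hG' => hiff ⟨fun _ => hG', fun _ => hF⟩
        have h0 : fixedCoef F r f₁ ρ e t G w = 0 := by
          unfold fixedCoef; rw [if_neg]; intro h₁
          exact hp ((h₁ p hF.1 hF.2 hG').symm.trans ht.symm)
        rw [h0, zero_mul]
      · have hG' : ρ ≤ p.val ∧ p.val < ρ + e := by
          by_contra hG'; exact hiff ⟨fun hF' => absurd hF' hF, fun hG'' => absurd hG'' hG'⟩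
        have h0 : freeCoef F r f₁ ρ e t c w = 0 := by
          unfold freeCoef; rw [if_neg]; rintro ⟨-, -, -, h₄⟩
          exact hp ((h₄ p hF hG').symm.trans ht.symm)
        rw [h0, mul_zero]
  · exact fun h => absurd (Finset.mem_univ _) h

/-- **`Λ_r` of a framed body, uniformly in the scheme** `m ∈ {0,1,2}` (`F = [m·r, m·r+2r)`):
`Λ_r (α·G·ω) = Σ_t fixed_t(X,Y) · free_t(X,Y)` with the matrices read off at the block words
`blockWord x y x y` — blocks 12 straight, 23 twisted, 34 straight.
[cite: HrubesWigdersonYehudayoff2010, Lemma C.2, Prop. C.3] -/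
theorem blockForm_framed {r ρ e : ℕ} (m : Fin 3) (hρe : ρ + e ≤ 4 * r)
    {G : FreeAlgebra F (Fin 2)} (hG : degPart (4 * r) e G = G) (c : Fin (4 * r) → Fin 2) :
    blockForm F r (framed hρe c G) = ∑ t : Fin (4 * r) → Fin 2,
      HWY10.bilinForm F (fun x y => fixedCoef F r (m.val * r) ρ e t G (blockWord r x y x y)) *
        HWY10.bilinForm F (fun x y => freeCoef F r (m.val * r) ρ e t c (blockWord r x y x y)) := by
  classical
  have hs := fun i j i' j' =>
    coeff_framed_eq_sum F (f₁ := m.val * r) hρe hG c (blockWord r i j i' j')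
  obtain hm | hm | hm : m.val = 0 ∨ m.val = 1 ∨ m.val = 2 := by have := m.isLt; omega
  all_goals simp only [hm] at hs ⊢
  · refine blockForm_eq_sum F r Finset.univ fun i j i' j' => ?_
    rw [hs]
    refine Finset.sum_congr rfl fun t _ => ?_
    rw [fixedCoef_congr F t G (w' := blockWord r i j i j) fun p a b =>
        blockWord_eq r i j i' j' i j i j p (fun _ => rfl) (fun _ _ => rfl)
          (fun h _ => absurd h (by omega)) (fun h => absurd h (by omega)),
      freeCoef_congr F t c (w' := blockWord r i' j' i' j') fun p a =>
        blockWord_eq r i j i' j' i' j' i' j' p (fun h => absurd h (by omega))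
          (fun _ h => absurd h (by omega)) (fun _ _ => rfl) (fun _ => rfl)]
  · conv_rhs => arg 2; ext t; rw [mul_comm]
    refine blockForm_eq_sum_twist F r Finset.univ fun i j i' j' => ?_
    rw [hs]
    refine Finset.sum_congr rfl fun t _ => ?_
    rw [fixedCoef_congr F t G (w' := blockWord r i' j i' j) fun p a b =>
        blockWord_eq r i j i' j' i' j i' j p (fun h => absurd h (by omega)) (fun _ _ => rfl)
          (fun _ _ => rfl) (fun h => absurd h (by omega)),
      freeCoef_congr F t c (w' := blockWord r i j' i j') fun p a =>
        blockWord_eq r i j i' j' i j' i j' p (fun _ => rfl) (fun h₁ h₂ => absurd h₂ (by omega))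
          (fun h₁ h₂ => absurd h₁ (by omega)) (fun _ => rfl),
      mul_comm]
  · conv_rhs => arg 2; ext t; rw [mul_comm]
    refine blockForm_eq_sum F r Finset.univ fun i j i' j' => ?_
    rw [hs]
    refine Finset.sum_congr rfl fun t _ => ?_
    rw [fixedCoef_congr F t G (w' := blockWord r i' j' i' j') fun p a b =>
        blockWord_eq r i j i' j' i' j' i' j' p (fun h => absurd h (by omega))
          (fun _ h => absurd h (by omega)) (fun _ _ => rfl) (fun _ => rfl),
      freeCoef_congr F t c (w' := blockWord r i j i j) fun p a =>
        blockWord_eq r i j i' j' i j i j p (fun _ => rfl) (fun _ _ => rfl)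
          (fun h₁ h₂ => absurd h₁ (by omega)) (fun h => absurd h (by have := p.isLt; omega)),
      mul_comm]

end FrameSplit

section Count

/-- Words on `n` positions vanishing where `[f₁, f₁+k)` and `[ρ, ρ+e)` agree: at most `2^{|F Δ G|}`.
[cite: HrubesWigdersonYehudayoff2010, Prop. C.3 (the count `2^{O(k)}`)] -/
theorem card_supported_le (n f₁ ρ e k : ℕ) :
    (Finset.univ.filter fun t : Fin n → Fin 2 =>
      ∀ p : Fin n, ((f₁ ≤ p.val ∧ p.val < f₁ + k) ↔ (ρ ≤ p.val ∧ p.val < ρ + e)) → t p = 0).card ≤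
      2 ^ ((f₁ - ρ) + (ρ - f₁) + (f₁ + k - (ρ + e)) + (ρ + e - (f₁ + k))) := by
  classical
  set D : Finset (Fin n) := Finset.univ.filter fun p : Fin n =>
    ¬((f₁ ≤ p.val ∧ p.val < f₁ + k) ↔ (ρ ≤ p.val ∧ p.val < ρ + e)) with hD
  have hmem : ∀ p : Fin n, p ∉ D →
      ((f₁ ≤ p.val ∧ p.val < f₁ + k) ↔ (ρ ≤ p.val ∧ p.val < ρ + e)) :=
    fun p hp => by by_contra h; exact hp (Finset.mem_filter.2 ⟨Finset.mem_univ _, h⟩)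
  have hDc : D.card ≤ (f₁ - ρ) + (ρ - f₁) + (f₁ + k - (ρ + e)) + (ρ + e - (f₁ + k)) := by
    have hsub : D.map Fin.valEmbedding ⊆ Finset.Ico (f₁ - (f₁ - ρ)) (f₁ + (ρ - f₁)) ∪
        Finset.Ico (f₁ + k - (f₁ + k - (ρ + e))) (f₁ + k + (ρ + e - (f₁ + k))) := by
      intro x hx
      rw [Finset.mem_map] at hx
      obtain ⟨p, hp, rfl⟩ := hx
      rw [hD, Finset.mem_filter] at hp
      obtain ⟨-, hp⟩ := hp
      simp only [Finset.mem_union, Finset.mem_Ico, Fin.valEmbedding_apply]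
      omega
    calc D.card = (D.map Fin.valEmbedding).card := (Finset.card_map _).symm
      _ ≤ _ := Finset.card_le_card hsub
      _ ≤ _ := Finset.card_union_le _ _
      _ = _ := by simp only [Nat.card_Ico]; omega
  calc _ ≤ (Finset.univ : Finset (↥D → Fin 2)).card := by
        refine Finset.card_le_card_of_injOn (fun t p => t p.1) (fun _ _ => by simp) ?_
        intro t ht t' ht' heq
        have h₁ := (Finset.mem_filter.1 (Finset.mem_coe.1 ht)).2
        have h₂ := (Finset.mem_filter.1 (Finset.mem_coe.1 ht')).2
        funext p
        by_cases hp : p ∈ D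
        · exact congrFun heq ⟨p, hp⟩
        · rw [h₁ p (hmem p hp), h₂ p (hmem p hp)]
    _ = 2 ^ D.card := by
        rw [Finset.card_univ, Fintype.card_fun, Fintype.card_fin, Fintype.card_coe]
    _ ≤ _ := Nat.pow_le_pow_right (by norm_num) hDc

end Count

end Summit.ValiantsHypothesis.ValiantsHypothesis.Theorems.NcFrameSplit

end
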